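import Summits.Ventures.PercRepro.C025ProfileHallDelete
import Summits.Ventures.PercRepro.C025ProfileHallLoop
import Summits.Ventures.PercRepro.C025ProfileAll

/-!
# C-033 «SHADOW HALL (H⁺)» — THE ROW `q = 1` FOR EVERY FINITE MATROID AND EVERY FAMILY (night-3 g7)

`hallIneq_one_all (M) [M.Finite] (u) (hu : 1 ≤ u) : Profile.HallIneq M 1 u`: for every finite matroid `M`, every level
`u ≥ 1` and every family `𝒜` of rank-`1` sets,

  `#{S ⊆ E : ρ(S) = u, S ⊇ B for some B ∈ 𝒜}  ≥  Σ_{B ∈ 𝒜, ρ(E∖B) ≥ u} C(ρ(E∖B)+1, u) / (ρ(E∖B)+1)`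

— the Hall / normalized-matching form `(H⁺_{1,u})` of NIGHT3-G6-PROFILE.md §2, i.e. `ProfileHall` at `q = 1`
(`profileHall_row_one`). Strong induction on `|E|`, all levels at once:
* a loop `ℓ`: `hallIneq_of_delete_isLoop` (`C025ProfileHallLoop`) lifts the inequality from `M ＼ {ℓ}`;
* a parallel pair `e ∥ f`: `hallIneq_one_of_delete_parallel` (`C025ProfileHallParallel`) lifts it from `M ＼ {e}`;
* `M` simple (`simple_of_no_loop_no_parallel`): the rank-`1` sets are the points (`finset_eq_singleton_of_eRk_one_of_simple`).
  If `𝒜` is ALL of them, the shadow is the whole level (`shadowLevel_Rq_one_eq_levelSet`) and the inequality is the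
  profile inequality `(Π_{1,u})`, the tree theorem `profileIneq_one_all` (`C025ProfileAll`); otherwise a point `e` is
  missing from `𝒜`, `e ∉ cl{x}` for every member `{x}` (no parallel pair), and `hallIneq_of_delete_contract`
  (`C025ProfileHallDelete`) lifts the inequality from `(H⁺_{1,u})(M ＼ e)` and `(H⁺_{1,u−1})(M ／ e)`;
* the level `u = 1` is direct (`hallIneq_one_one`: every member is in its own shadow and pays at most `1`).
-/

open scoped Matroid

namespace PercRepro

open Set Finset ThmH

section HallOne

variable {α : Type} [DecidableEq α] {M : Matroid α} [M.Finite]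

omit [DecidableEq α] in
/-- In a simple matroid a rank-`1` finset of the ground set is a singleton (the finset form of
`eq_singleton_of_eRk_one_of_simple`, C025ProfileCases). -/
theorem finset_eq_singleton_of_eRk_one_of_simple (hsimple : ∀ T ⊆ M.E, T.encard ≤ 2 → M.Indep T) {B : Finset α}
    (hB : B ⊆ gr M) (h1 : M.eRk (B : Set α) = 1) : ∃ x, B = {x} := by
  obtain ⟨x, -, hx⟩ := eq_singleton_of_eRk_one_of_simple hsimple (X := (B : Set α))
    (by rw [← coe_gr]; exact_mod_cast hB) h1
  exact ⟨x, by rw [← Finset.coe_inj, hx, Finset.coe_singleton]⟩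

/-- In a loopless matroid the shadow of ALL rank-`1` sets at a level `u ≥ 1` is the whole level. -/
theorem shadowLevel_Rq_one_eq_levelSet (hl : ∀ x ∈ M.E, M.IsNonloop x) {u : ℕ} (hu : 1 ≤ u) :
    Shadow.shadowLevel M u (Profile.Rq M 1) = Shadow.levelSet M u := by
  refine Finset.Subset.antisymm (Finset.filter_subset _ _) ?_
  intro S hS
  rw [mem_shadowLevel]
  refine ⟨hS, ?_⟩
  rw [Profile.mem_levelSet] at hS
  have hne : S.Nonempty := by
    rw [Finset.nonempty_iff_ne_empty]
    rintro rfl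
    simp only [Finset.coe_empty, Matroid.eRk_empty] at hS
    have := hS.2
    have : (u : ℕ∞) = 0 := this.symm
    have hu0 : u = 0 := by exact_mod_cast this
    omega
  obtain ⟨x, hx⟩ := hne
  refine ⟨{x}, ?_, Finset.singleton_subset_iff.2 hx⟩
  rw [Profile.mem_Rq]
  refine ⟨Finset.singleton_subset_iff.2 (hS.1 hx), ?_⟩
  rw [Finset.coe_singleton]
  exact (hl x (by rw [← coe_gr]; exact_mod_cast hS.1 hx)).eRk_eq

/-- The level `u = 1` of `(H⁺_{1,·})` for every matroid: every member is a rank-`1` set in its own shadow and pays at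
most `1`. -/
theorem hallIneq_one_one (M : Matroid α) [M.Finite] : Profile.HallIneq M 1 1 := by
  intro 𝒜 h𝒜
  have hprice : ∀ B ∈ 𝒜, Profile.price M 1 1 B ≤ 1 := by
    intro B _
    rw [price_one_eq]
    unfold P1
    split_ifs with h
    · rw [Nat.choose_one_right]
      push_cast
      exact le_of_eq (div_self (by positivity))
    · exact zero_le_one
  have hsub : 𝒜 ⊆ Shadow.shadowLevel M 1 𝒜 := by
    intro B hB
    rw [mem_shadowLevel]
    exact ⟨h𝒜 hB, B, hB, subset_refl _⟩
  calc ∑ B ∈ 𝒜, Profile.price M 1 1 B ≤ ∑ _B ∈ 𝒜, (1 : ℚ) := Finset.sum_le_sum hprice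
    _ = (𝒜.card : ℚ) := by rw [Finset.sum_const, nsmul_eq_mul, mul_one]
    _ ≤ ((Shadow.shadowLevel M 1 𝒜).card : ℚ) := by exact_mod_cast Finset.card_le_card hsub

/-- **The row `q = 1` of C-033 for every finite matroid and every family**: `(H⁺_{1,u})` for all `u ≥ 1`. -/
theorem hallIneq_one_all (M : Matroid α) [M.Finite] (u : ℕ) (hu : 1 ≤ u) : Profile.HallIneq M 1 u := by
  suffices h : ∀ n : ℕ, ∀ (N : Matroid α) [N.Finite], (gr N).card = n → ∀ u : ℕ, 1 ≤ u → Profile.HallIneq N 1 u from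
    h _ M rfl u hu
  intro n
  induction n using Nat.strong_induction_on with
  | _ n ih =>
  intro N _ hN u hu
  by_cases hloop : ∃ ℓ, N.IsLoop ℓ
  · obtain ⟨ℓ, hℓ⟩ := hloop
    have hℓE : ℓ ∈ gr N := by rw [← Finset.mem_coe, coe_gr]; exact hℓ.mem_ground
    apply hallIneq_of_delete_isLoop hℓ
    apply ih ((gr N).erase ℓ).card _ (N ＼ ({ℓ} : Set α)) (by rw [gr_delete_singleton'']) u hu
    rw [← hN]; exact Finset.card_erase_lt_of_mem hℓE
  · have hl : ∀ x ∈ N.E, N.IsNonloop x := fun x hx => N.isNonloop_of_not_isLoop hx (fun h => hloop ⟨x, h⟩)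
    by_cases hpar : ∃ e f, f ∈ N.E ∧ f ≠ e ∧ e ∈ N.closure {f}
    · obtain ⟨e, f, hfE, hfe, hef⟩ := hpar
      have heE : e ∈ gr N := by rw [← Finset.mem_coe, coe_gr]; exact N.closure_subset_ground _ hef
      obtain ⟨u', rfl⟩ : ∃ u', u = u' + 1 := ⟨u - 1, by omega⟩
      apply hallIneq_one_of_delete_parallel hl hfE hfe hef u'
      apply ih ((gr N).erase e).card _ (N ＼ ({e} : Set α)) (by rw [gr_delete_singleton'']) (u' + 1) hu
      rw [← hN]; exact Finset.card_erase_lt_of_mem heE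
    · push Not at hpar
      have hsimple := simple_of_no_loop_no_parallel hl hpar
      intro 𝒜 h𝒜
      by_cases hall : Profile.Rq N 1 ⊆ 𝒜
      · -- the full family: the profile inequality (Π_{1,u})
        have h𝒜eq : 𝒜 = Profile.Rq N 1 := Finset.Subset.antisymm h𝒜 hall
        rw [h𝒜eq, shadowLevel_Rq_one_eq_levelSet hl hu]
        exact profileIneq_one_all N u hu
      · -- a missing point e: delete and contract it
        rw [Finset.not_subset] at hall
        obtain ⟨B₀, hB₀R, hB₀𝒜⟩ := hall
        have hB₀R' := hB₀R
        rw [Profile.mem_Rq] at hB₀R'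
        obtain ⟨e, rfl⟩ := finset_eq_singleton_of_eRk_one_of_simple hsimple hB₀R'.1 (by exact_mod_cast hB₀R'.2)
        have heE : e ∈ gr N := Finset.singleton_subset_iff.1 hB₀R'.1
        have heE' : e ∈ N.E := by rw [← coe_gr]; exact_mod_cast heE
        have he : N.Indep {e} := N.indep_singleton.2 (hl e heE')
        have hcl : ∀ B ∈ 𝒜, e ∉ N.closure (B : Set α) := by
          intro B hB
          have hBR := h𝒜 hB
          rw [Profile.mem_Rq] at hBR
          obtain ⟨x, rfl⟩ := finset_eq_singleton_of_eRk_one_of_simple hsimple hBR.1 (by exact_mod_cast hBR.2)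
          have hxE : x ∈ N.E := by rw [← coe_gr]; exact_mod_cast Finset.singleton_subset_iff.1 hBR.1
          have hxe : x ≠ e := by
            rintro rfl
            exact hB₀𝒜 hB
          rw [Finset.coe_singleton]
          exact hpar e x hxE hxe
        obtain ⟨u', rfl⟩ : ∃ u', u = u' + 1 := ⟨u - 1, by omega⟩
        by_cases hu' : u' = 0
        · subst hu'
          exact hallIneq_one_one N 𝒜 h𝒜
        · have hlt : ((gr N).erase e).card < n := by
            rw [← hN]; exact Finset.card_erase_lt_of_mem heE
          have hd : Profile.HallIneq (N ＼ ({e} : Set α)) 1 (u' + 1) :=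
            ih _ hlt (N ＼ ({e} : Set α)) (by rw [gr_delete_singleton'']) (u' + 1) hu
          have hc : Profile.HallIneq (N ／ ({e} : Set α)) 1 u' :=
            ih _ hlt (N ／ ({e} : Set α)) (by rw [gr_contract_singleton]) u' (by omega)
          exact hallIneq_of_delete_contract he 1 u' hd hc h𝒜 hcl

/-- The `q = 1` instance of `ProfileHall` exactly as the Hall form is stated there (`q < u`, every family of rank-`1`
sets): **the row `q = 1` of C-033 is a theorem for every finite matroid**. -/
theorem profileHall_row_one (M : Matroid α) [M.Finite] (u : ℕ) (hqu : 1 < u) :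
    ∀ 𝒜 ⊆ Profile.Rq M 1, ∑ B ∈ 𝒜, Profile.price M 1 u B ≤ ((Shadow.shadowLevel M u 𝒜).card : ℚ) :=
  hallIneq_one_all M u hqu.le

end HallOne

end PercRepro
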